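import Mathlib

/-!
# Crux `HilbertIntegralOverconvergentIsCongruence` (stmt-Langlands-8485), line `Sketch-ideate-r1-k1`:
# the algebraization engine, `d = 1` — III. from the Siegel solution to the classical relation

Part III of the proof of the registered stub R8 `stub_algebraicMain` (RESHAPE 4 of the skeleton
`Cruxes/HilbertIntegralOverconvergentIsCongruence/Lines/Sketch_ideate_r1_k1.lean`):

* `algMain_unitriangular_indep` — a unitriangular finite family of power series is linearly independent;
* `algMain_qExpansion_sum`, `algMain_qExpansion_smul` — `q`-expansions of linear combinations of
  level-one forms;
* `stub_conclude` (registered stub R8c) — from a non-zero integral solution `P` of the Siegel system,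
  indexed by `β D = Σ_{j < D} J(bw j)` over the unitriangular integral basis `Ff b i` (`q`-expansions
  `Pf b i ∈ ℤ⟦q⟧`, order `i`, leading coefficient `1`), whose complex shadow
  `Σ_u σ₀(P_u) · Pf_u · g^{j_u}` vanishes: the level-one forms `F_j = Σ_i σ₀(P_{j,i}) Ff_{bw j, i}` of
  weight `12uD - jk` give a NON-TRIVIAL relation `Σ_{j ≤ D} F_j · g^j = 0`.

Theorems only, no `sorry`.
-/

set_option linter.dupNamespace false

noncomputable section

open scoped MatrixGroups NumberField

namespace Summit.Langlands.Langlands.Theorems.HilbertIntegralOverconvergentIsCongruence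

/-! ### Unitriangular families are linearly independent -/

/-- A finite family of power series `f i` (`i ∈ s`) over a field with `f i` vanishing below `qⁱ` and
coefficient `1` at `qⁱ` is linearly independent: a vanishing linear combination has all
coefficients zero. [folklore] -/
theorem algMain_unitriangular_indep {L : Type*} [Field L] (s : Finset ℕ) (f : ℕ → PowerSeries L)
    (hf : ∀ i ∈ s, (∀ n < i, PowerSeries.coeff n (f i) = 0) ∧ PowerSeries.coeff i (f i) = 1)
    (c : ℕ → L) (hc : ∑ i ∈ s, c i • f i = 0) : ∀ i ∈ s, c i = 0 := by
  classical
  by_contra hne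
  push Not at hne
  -- the least index with a non-zero coefficient
  obtain ⟨i₀, hi₀s, hci₀, hmin⟩ : ∃ i₀ ∈ s, c i₀ ≠ 0 ∧ ∀ i ∈ s, c i ≠ 0 → i₀ ≤ i := by
    have hexists : ∃ i, i ∈ s ∧ c i ≠ 0 := by
      obtain ⟨i, hi, hci⟩ := hne
      exact ⟨i, hi, hci⟩
    refine ⟨Nat.find hexists, (Nat.find_spec hexists).1, (Nat.find_spec hexists).2, ?_⟩
    intro i hi hci
    exact Nat.find_min' hexists ⟨hi, hci⟩
  have hcoeff := congrArg (PowerSeries.coeff i₀) hc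
  rw [map_sum, map_zero, Finset.sum_eq_single i₀] at hcoeff
  · rw [map_smul, (hf i₀ hi₀s).2, smul_eq_mul, mul_one] at hcoeff
    exact hci₀ hcoeff
  · intro i hi hne'
    rw [map_smul, smul_eq_mul]
    rcases lt_or_gt_of_ne hne' with h | h
    · -- `i < i₀`: then `c i = 0` by minimality
      have : c i = 0 := by
        by_contra h'
        exact absurd (hmin i hi h') (not_le.mpr h)
      rw [this, zero_mul]
    · rw [(hf i hi).1 i₀ h, mul_zero]
  · intro h
    exact absurd hi₀s h

/-! ### `q`-expansions of finite linear combinations of level-one forms -/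

/-- The `q`-expansion of a finite sum of modular forms of the same weight and level one is the sum of
the `q`-expansions. [folklore] -/
theorem algMain_qExpansion_sum {ι' : Type*} {w : ℤ} (s : Finset ι') (G : ι' → ModularForm 𝒮ℒ w) :
    UpperHalfPlane.qExpansion 1 ⇑(∑ i ∈ s, G i) = ∑ i ∈ s, UpperHalfPlane.qExpansion 1 ⇑(G i) := by
  classical
  have hΓ : (1 : ℝ) ∈ (𝒮ℒ).strictPeriods := one_mem_strictPeriods_SL
  induction s using Finset.induction_on with
  | empty => rw [Finset.sum_empty, Finset.sum_empty, ModularForm.coe_zero, UpperHalfPlane.qExpansion_zero]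
  | insert i s his ih =>
    rw [Finset.sum_insert his, Finset.sum_insert his, ModularForm.coe_add,
      ModularForm.qExpansion_add one_pos hΓ, ih]

/-- The `q`-expansion of a scalar multiple of a level-one modular form. [folklore] -/
theorem algMain_qExpansion_smul {w : ℤ} (a : ℂ) (G : ModularForm 𝒮ℒ w) :
    UpperHalfPlane.qExpansion 1 ⇑(a • G) = a • UpperHalfPlane.qExpansion 1 ⇑G := by
  have hΓ : (1 : ℝ) ∈ (𝒮ℒ).strictPeriods := one_mem_strictPeriods_SL
  rw [ModularForm.IsGLPos.coe_smul, ModularForm.qExpansion_smul one_pos hΓ]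


/-! ### From the Siegel solution to the classical relation (registered stub R8c) -/

/-- **Registered stub R8c (`stub_conclude`) of line `Sketch-ideate-r1-k1`.**  `D ≥ 1`-many weights
`bw j` with `bw j = 12uD - jk` for `j ≤ D`; the integral unitriangular basis `Ff b i` (`i ∈ J b`) with
integer `q`-expansions `Pf b i` of order `i` and leading coefficient `1`; a NON-ZERO family
`P : (Σ_{j < D} J(bw j)) → 𝓞_E` whose complex shadow `Σ_u σ₀(P_u) · Pf_u · g^{j_u}` vanishes
(`g = Σ σ₀(aₙ) qⁿ`).  Then the level-one forms `F_j = Σ_{i ∈ J(bw j)} σ₀(P_{j,i}) · Ff_{bw j, i}`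
(`j < D`, `F_D = 0`) have weights `b_j = 12uD - jk` with `b_j + jk = b_0`, satisfy
`Σ_{j ≤ D} F_j · g^j = 0`, and some `F_j ≠ 0` (unitriangularity + injectivity of `σ₀` and of
`𝓞_E → E`). [folklore] -/
theorem stub_conclude (k : ℤ) (u D : ℕ) (E : Type) [Field E] [NumberField E] (σ₀ : E →+* ℂ) (a : ℕ → E)
    (J : ℕ → Finset ℕ) (bw : ℕ → ℕ)
    (hbw : ∀ jj : ℕ, jj ≤ D → ((bw jj : ℕ) : ℤ) = ((12 * u * D : ℕ) : ℤ) - jj * k)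
    (Ff : (b i : ℕ) → i ∈ J b → ModularForm 𝒮ℒ (b : ℤ)) (Pf : (b i : ℕ) → i ∈ J b → PowerSeries ℤ)
    (hFP : ∀ (b i : ℕ) (h : i ∈ J b),
      UpperHalfPlane.qExpansion 1 ⇑(Ff b i h) = (Pf b i h).map (Int.castRingHom ℂ))
    (hPlt : ∀ (b i : ℕ) (h : i ∈ J b), ∀ n < i, PowerSeries.coeff n (Pf b i h) = 0)
    (hPi : ∀ (b i : ℕ) (h : i ∈ J b), PowerSeries.coeff i (Pf b i h) = 1)
    (P : ((jj : Fin D) × ↥(J (bw jj))) → 𝓞 E) (hP0 : P ≠ 0)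
    (hrelC : ∑ uu : (jj : Fin D) × ↥(J (bw jj)), σ₀ ((P uu : 𝓞 E) : E) •
      ((Pf (bw uu.1) uu.2.1 uu.2.2).map (Int.castRingHom ℂ) *
        (PowerSeries.mk fun n ↦ σ₀ (a n)) ^ (uu.1 : ℕ)) = 0) :
    ∃ (D' : ℕ) (b : ℕ → ℤ) (F : (j : ℕ) → ModularForm 𝒮ℒ (b j)),
      (∃ j ≤ D', F j ≠ 0) ∧ (∀ j, b j + j * k = b 0) ∧
      ∑ j ∈ Finset.range (D' + 1),
        UpperHalfPlane.qExpansion 1 ⇑(F j) * (PowerSeries.mk fun n ↦ σ₀ (a n)) ^ j = 0 := by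
  classical
  -- the coefficient forms of weight `b_j = 12 u D - j k`, `j < D`
  let FF : (jj : ℕ) → jj < D → ModularForm 𝒮ℒ ((((12 * u * D : ℕ) : ℤ)) - jj * k) := fun jj h ↦
    ModularForm.mcast (hbw jj h.le)
      (∑ i ∈ (J (bw jj)).attach, (σ₀ ((P ⟨⟨jj, h⟩, i⟩ : 𝓞 E) : E)) • Ff (bw jj) i.1 i.2)
  have hFFq : ∀ (jj : ℕ) (h : jj < D), UpperHalfPlane.qExpansion 1 ⇑(FF jj h) =
      ∑ i ∈ (J (bw jj)).attach, (σ₀ ((P ⟨⟨jj, h⟩, i⟩ : 𝓞 E) : E)) •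
        PowerSeries.map (Int.castRingHom ℂ) (Pf (bw jj) i.1 i.2) := by
    intro jj h
    change UpperHalfPlane.qExpansion 1 ⇑(ModularForm.mcast _ _) = _
    rw [ModularForm.qExpansion_mcast, algMain_qExpansion_sum]
    refine Finset.sum_congr rfl fun i _ ↦ ?_
    rw [algMain_qExpansion_smul, hFP]
  refine ⟨D, fun jj ↦ (((12 * u * D : ℕ) : ℤ)) - jj * k, fun jj ↦ if h : jj < D then FF jj h else 0,
    ?_, fun jj ↦ by push_cast; ring, ?_⟩
  · -- some `F_j` is non-zero: unitriangularity of the basis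
    obtain ⟨uu₀, huu₀⟩ : ∃ uu, P uu ≠ 0 := Function.ne_iff.mp hP0
    refine ⟨uu₀.1, (Fin.is_lt uu₀.1).le, ?_⟩
    dsimp only
    rw [dif_pos (Fin.is_lt uu₀.1)]
    intro hzero
    apply huu₀
    set b : ℕ := bw uu₀.1 with hb_def
    have hq : UpperHalfPlane.qExpansion 1 ⇑(FF uu₀.1 (Fin.is_lt uu₀.1)) = 0 := by
      rw [hzero, ModularForm.coe_zero, UpperHalfPlane.qExpansion_zero]
    rw [hFFq] at hq
    -- reindex over `J b`
    let cJ : ℕ → ℂ := fun i ↦ if h : i ∈ J b then σ₀ ((P ⟨uu₀.1, ⟨i, h⟩⟩ : 𝓞 E) : E) else 0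
    let fJ : ℕ → PowerSeries ℂ := fun i ↦
      if h : i ∈ J b then PowerSeries.map (Int.castRingHom ℂ) (Pf b i h) else 0
    have hsum : ∑ i ∈ J b, cJ i • fJ i = 0 := by
      rw [← Finset.sum_attach (J b) (fun i ↦ cJ i • fJ i), ← hq]
      refine Finset.sum_congr rfl fun i _ ↦ ?_
      simp only [cJ, fJ, dif_pos i.2]
      rfl
    have hf : ∀ i ∈ J b,
        (∀ n < i, PowerSeries.coeff n (fJ i) = 0) ∧ PowerSeries.coeff i (fJ i) = 1 := by
      intro i hi
      simp only [fJ, dif_pos hi]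
      refine ⟨fun n hn ↦ ?_, ?_⟩
      · rw [PowerSeries.coeff_map, hPlt b i hi n hn, map_zero]
      · rw [PowerSeries.coeff_map, hPi b i hi, map_one]
    have hc := algMain_unitriangular_indep (J b) fJ hf cJ hsum uu₀.2 uu₀.2.2
    have hσ : σ₀ ((P uu₀ : 𝓞 E) : E) = 0 := by
      have hcJ : cJ uu₀.2 = σ₀ ((P uu₀ : 𝓞 E) : E) := by
        have huu : (⟨uu₀.1, ⟨(uu₀.2 : ℕ), uu₀.2.2⟩⟩ : (jj : Fin D) × ↥(J (bw jj))) = uu₀ := by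
          obtain ⟨jj, i, hi⟩ := uu₀
          rfl
        simp only [cJ, dif_pos (show ((uu₀.2 : ℕ)) ∈ J b from uu₀.2.2), huu]
      rw [← hcJ, hc]
    have hPE : ((P uu₀ : 𝓞 E) : E) = 0 := σ₀.injective (hσ.trans (map_zero σ₀).symm)
    exact NumberField.RingOfIntegers.coe_injective (hPE.trans (map_zero _).symm)
  · -- the relation `Σ_j F_j g^j = 0`
    rw [Finset.sum_range_succ]
    dsimp only
    rw [dif_neg (lt_irrefl D), ModularForm.coe_zero, UpperHalfPlane.qExpansion_zero, zero_mul, add_zero,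
      ← Fin.sum_univ_eq_sum_range (fun jj ↦ UpperHalfPlane.qExpansion 1
        ⇑(if h : jj < D then FF jj h else 0) * (PowerSeries.mk fun n ↦ σ₀ (a n)) ^ jj) D,
      ← hrelC, Fintype.sum_sigma]
    refine Finset.sum_congr rfl fun jj _ ↦ ?_
    obtain ⟨jj, hjj⟩ := jj
    dsimp only
    rw [dif_pos hjj, hFFq, Finset.sum_mul, Finset.univ_eq_attach]
    refine Finset.sum_congr rfl fun i _ ↦ ?_
    rw [smul_mul_assoc]

end Summit.Langlands.Langlands.Theorems.HilbertIntegralOverconvergentIsCongruence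

end
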